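import Summits.ABC.IUTFork.Joshi.ArithTeichmullerAction
import Mathlib.FieldTheory.IntermediateField.Adjoin.Basic
import Mathlib.FieldTheory.Galois.Basic
import HarnessLib

/-!
# Joshi, *Construction of Arithmetic Teichmüller Spaces I* (arXiv:2106.11452v4) §3 — the remainder: Thm. 3.10.1,
# Rmks. 3.16.2/3.16.3, Question 3.18.1 (+ the [BGR] step of the proof of Thm. 3.16.1), TYPED over E-t1's carriers

Record file of the abc-iut cell, branch E «type Joshi's construction, test vs S» (rung LADDER-ABC:A2.E; seat
abc-iut-E-t24, slot T-45 of the [J-I] fan-out; inventory `HOME/plan/E/t24/INVENTORY-T45.tsv`; companion file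
`ATS1ClassicalTeichmuller.lean` for §2). Source: K. Joshi, arXiv 2106.11452 **v4** (bib `Joshi2021ATS1`, UNREFEREED, typed
AS A CANDIDATE, D-0012); render `HOME/plan/repair/lit/renders/Joshi-ATS1-2106.11452v4-PDFpaged-book-anonnd/` («p.N l.M» =
line M of page file pNNNN.txt). TYPED ≠ PROVED ≠ ENDORSED; nothing here asserts abc or [IUTchIII] Cor. 3.12 or takes a side
on any author; what the paper ASSERTS is a `Prop`-valued definition tagged `@[claim "Joshi2021ATS1" "disputed"]` (E-t1's
registered status word), never asserted; what it CITES is an `@[cite …]` `Prop`, equally unasserted (FACT-LIST freeze).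
E-t1's carriers `Untilt` (+ `TopEquiv`/`TopIso`/`padicComplex`), `ATSObj` (+ `self`), `UntiltPoints` (+ `ExistsNonIsomorphic`)
are IMPORTED BY NAME (p428170, p429850; r1/r3, R12); Thm. 3.16.1 is E-t1's (`ATSObj.not_isIso_of_not_topIso`), NOT restated.

## What is printed and how it is typed

* §3.5–§3.6 (p.9 l.38 – p.10 l.14) «untilts `K` … equipped with continuous embeddings `E ↪ K`»: `EUntilt X` bundles the
  three arguments of E-t1's `ATSObj.self`; `EUntilt.toATSObj` IS `ATSObj.self`. Merge-debt (R12): E-t17's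
  `ATS1.GalUntiltObj E` (§7.3) is the same pair WITHOUT the continuity clause.
* §3.10 (p.10 l.58 – p.11 l.19): in the tree's [SemiAnbd] §6 interface `TemperedCurve p` (`E = X.K ⊆ K̄ = AlgebraicClosure
  ℚ_[p]`, `Π^temp_{X/E} = X.PiTemp`, augmentation `X.aug` onto `G_E = X.GK`), [André 2003a, Prop. 2.1.8] identifies
  `Π^temp_{X_{E′}/E′}` (finite `E′ ⊇ E`) with the preimage of `G_{E′}`: `piTempFin`; their inverse limit (injective
  transition maps) is the intersection `piTempLim`. **PROVED** `piTempLim_eq_deltaTemp`: `lim_{E′} Π^temp_{X_{E′}/E′} =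
  Δ^temp_X := Ker(Π^temp_{X/E} → G_E)` — the group-theoretic content of display (3.10.2) in this interface.
* **Thm. 3.10.1** (p.11 l.20–51): `Π^temp_{X/K}` for an untilt `K ⊇ E` is NOT in the interface ([Lepage 2010], [André
  2003b, Prop. 5.1.1]) → INTERIM CARRIER `GeomPiDatum X` (for every `E`-untilt a topological group with its map to
  `Π^temp_{X/E}`); items (1)(2)(3) verbatim as claim-`Prop`s `Thm3101_1/2/3` (literal «continuous isomorphism») and
  `Thm3101_1top/3top` (reading «isomorphism of topological groups», the words of Thm. 3.16.1 (1), p.15 l.33). **PROVED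
  among the typed statements**: (1) ⟺ (2), (1)top ⟹ (1), (1)top ⟹ (3)top ⟹ (3) (the paper's own proof of (3), p.12
  l.47–51), and NON-VACUITY: the intrinsic datum `Π^temp_{X/K} := Δ^temp_X` satisfies every item — exactly how E-t1's
  `ATSObj.geomSubgroup` reads (3).
* Rmk. 3.16.2 (p.16 l.5–7; [Schmidt 1933], [Kaplansky 1942, Thm. 8]): `ExistsUncountablyManyNonTopIso p`; Rmk. 3.16.3 (p.16
  l.8–12; [Kedlaya–Temkin 2018]): `UntiltPoints.ExistsUncountablyManyNonIsomorphic` on E-t1's signature, implying E-t1's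
  `ExistsNonIsomorphic` (PROVED bookkeeping). Cited `Prop`s, unasserted.
* Question 3.18.1 (p.17 l.6–11): a QUESTION, typed unasserted under one explicit reading (`Question3181`).
* [BGR 1.2.5/4, 1.3.1/4] step of the proof of Thm. 3.16.1 (p.15 l.50 – p.16 l.3): a ring isomorphism of untilts bounded both
  ways is an isometry, hence an E-t1 `TopEquiv` — classical, **PROVED** (`norm_map_le_of_bound`, `Untilt.TopEquiv.ofBounded`).

Faithfulness notes (no side taken): (a) print's `X/E` is ANY geometrically connected smooth quasi-projective variety; the
interface is hyperbolic curves over finite `E/ℚ_p` — TODO(general form); (b) «untilts of a fixed `F`» is idle for Thm.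
3.10.1 by the author's own proof («(1) is true assuming only that `K` is a complete algebraically closed field containing `E`
isometrically», p.11 l.52–54), so the carrier is indexed by ALL `E`-untilts (E-t1's `Untilt` records no tilt); (c) «finite
extensions `E′` of `E` contained in `K`» are read inside the fixed `K̄` (Joshi's `Ē ⊂ K`, p.11 l.8, = E-t16's
`Rosetta.PrefAlgClosure E K`, an isomorphic copy); (d) §3.11–§3.15, §3.17 carry no numbered item (Berkovich spaces stay outside
the tree, E-t1's interface boundary) and are quoted in docstrings only. [claim: Joshi2021ATS1, status: disputed]
-/

noncomputable section

namespace Summit.ABC.IUTFork.Joshi.ATS1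

open Literature.AnabelianGeometry.SemiGraphs (TemperedCurve GQp)
open scoped IntermediateField

variable {p : ℕ} [Fact p.Prime]

/-! ## 1. `E`-untilts (§3.5–§3.6) -/
/-- **An `E`-untilt receiving `E` continuously** (§3.5 p.9 l.38–40: «By an `E`-untilt of `F`, I will mean the data
`(E ↪ K, K♭ ≃ F)` where `E ↪ K` is an isometric embedding of a `p`-adic field `E` into a perfectoid field `K`, of
characteristic zero»; §3.6 p.10 l.8–14: «untilts `K`, of `F`, equipped with continuous embeddings `E ↪ K` with the valuation
of `K` providing a valuation on `E` which is equivalent to the natural `p`-adic valuation on `E`»), for `E = X.K`: E-t1's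
`Untilt` + embedding + continuity on `ℚ_p` — exactly the arguments of E-t1's `ATSObj.self`; the tilt `K♭ ≃ F` is not
recorded (E-t1's design; idle for Thm. 3.10.1, module docstring (b)). [claim: Joshi2021ATS1, status: disputed] -/
structure EUntilt (X : TemperedCurve p) : Type 1 where
  /-- the untilt `K` -/
  U : Untilt p
  /-- the embedding `E ↪ K` -/
  ι : X.K →+* U.K
  /-- … continuous on `ℚ_p` -/
  continuous_ι : Continuous fun x : ℚ_[p] => ι (algebraMap ℚ_[p] X.K x)

namespace EUntilt

variable {X : TemperedCurve p}

/-- The object `(X/E, E ↪ K, id)` of `𝔍(X,E)` attached to an `E`-untilt: E-t1's `ATSObj.self`, by name.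
[claim: Joshi2021ATS1, status: disputed] -/
def toATSObj (K : EUntilt X) : ATSObj X := ATSObj.self X K.U K.ι K.continuous_ι

variable (X) in
/-- `(ℂ_p, E ⊆ Q̄_p ↪ ℂ_p)` is an `E`-untilt (§3.2 p.9 l.15: «A typical example of such a field is … `ℂ_p`») — E-t1's
`Untilt.padicComplex` with `ATSObj.embPadicComplex`; a kernel WITNESS that `EUntilt X` is inhabited. [folklore] -/
def padicComplex : EUntilt X :=
  ⟨Untilt.padicComplex p, ATSObj.embPadicComplex X, ATSObj.continuous_embPadicComplex X⟩

variable (X) in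
/-- `E`-untilts exist (the type is inhabited by `ℂ_p`). [folklore] -/
theorem nonempty : Nonempty (EUntilt X) := ⟨padicComplex X⟩

end EUntilt

/-! ## 2. `Π^temp_{X_{E′}/E′}` for finite `E′/E` and their inverse limit (§3.10, display (3.10.2)) -/
/-- The finite extensions `E′` of `E = X.K` inside the fixed algebraic closure `K̄` (§3.10 p.10 l.58: «Let `E′/E` be a
finite extension of `E` with a continuous embedding `E′ ↪ K`»; p.11 l.36: «all finite extensions `E′` of `E` contained
in `K`» — read inside `K̄`, module docstring (c)). [claim: Joshi2021ATS1, status: disputed] -/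
def finExt (X : TemperedCurve p) : Set (IntermediateField ℚ_[p] (AlgebraicClosure ℚ_[p])) :=
  {E' | X.K ≤ E' ∧ FiniteDimensional ℚ_[p] E'}

/-- `E` itself is one of the `E′`. [folklore] -/
theorem self_mem_finExt (X : TemperedCurve p) : X.K ∈ finExt X := ⟨le_rfl, X.finiteDimensional_K⟩

/-- **`Π^temp_{X_{E′}/E′} ⊆ Π^temp_{X/E}`** for a finite `E′ ⊇ E` (§3.10 p.10 l.60 – p.11 l.6: «one has an exact sequence
by [André, 2003a, Prop. 2.1.8] `1 → Π^temp_{X_{E′}/E′} → Π^temp_{X/E} → Gal(E′/E) → 1`»): the preimage of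
`G_{E′} = Gal(K̄/E′)` under the augmentation — the exact sequence identifies `Π^temp_{X_{E′}/E′}` with this subgroup
(READING in the [SemiAnbd] §6 interface, where `Π^temp → G_E` is primitive). [claim: Joshi2021ATS1, status: disputed] -/
def piTempFin (X : TemperedCurve p) (E' : IntermediateField ℚ_[p] (AlgebraicClosure ℚ_[p])) : Subgroup X.PiTemp :=
  E'.fixingSubgroup.comap X.aug.toMonoidHom

/-- Membership in `Π^temp_{X_{E′}/E′}`: the image in `G_{ℚ_p}` fixes `E′`. [folklore] -/
theorem mem_piTempFin_iff (X : TemperedCurve p) (E' : IntermediateField ℚ_[p] (AlgebraicClosure ℚ_[p]))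
    (g : X.PiTemp) : g ∈ piTempFin X E' ↔ ∀ x ∈ E', X.aug g x = x := by
  simp [piTempFin, IntermediateField.mem_fixingSubgroup_iff]

/-- **`lim_{E′/E} Π^temp_{X_{E′}/E′}`** (§3.10 p.11 l.9–19: «By varying `E′` over all finite extensions of `E ↪ K` one
obtains (see [André, 2003b, Section 5.1]) an exact sequence of topological groups `1 → lim_{E′/E} Π^temp_{X_{E′}/E′} →
Π^temp_{X/E} → Gal(Ē/E) → 1`»): the inverse limit of the decreasing system of subgroups `piTempFin X E′` (injective
transition maps) realised as their intersection inside `Π^temp_{X/E}`. [claim: Joshi2021ATS1, status: disputed] -/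
def piTempLim (X : TemperedCurve p) : Subgroup X.PiTemp := ⨅ E' ∈ finExt X, piTempFin X E'

/-- Membership in the limit: the image in `G_{ℚ_p}` fixes every finite extension of `E`. [folklore] -/
theorem mem_piTempLim_iff (X : TemperedCurve p) (g : X.PiTemp) :
    g ∈ piTempLim X ↔ ∀ E' ∈ finExt X, ∀ x ∈ E', X.aug g x = x := by
  simp only [piTempLim, Subgroup.mem_iInf, mem_piTempFin_iff]

/-- An automorphism of `K̄ = Q̄_p` over `ℚ_p` fixing (pointwise) every finite extension of the finite extension `E` is
the identity: every `x ∈ K̄` is algebraic, so `E(x)/ℚ_p` is finite. Hence `⋂_{E′} Gal(K̄/E′) = 1`. [folklore] -/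
theorem iInf_fixingSubgroup_finExt_eq_bot (X : TemperedCurve p) :
    ⨅ E' ∈ finExt X, E'.fixingSubgroup = (⊥ : Subgroup (GQp p)) := by
  rw [eq_bot_iff]
  intro σ hσ
  simp only [Subgroup.mem_iInf, IntermediateField.mem_fixingSubgroup_iff] at hσ
  rw [Subgroup.mem_bot]
  ext x
  haveI := X.finiteDimensional_K
  have hx : IsIntegral ℚ_[p] x := Algebra.IsIntegral.isIntegral x
  haveI := IntermediateField.adjoin.finiteDimensional hx
  have hE' : X.K ⊔ ℚ_[p]⟮x⟯ ∈ finExt X := ⟨le_sup_left, inferInstance⟩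
  have hxmem : x ∈ X.K ⊔ ℚ_[p]⟮x⟯ :=
    (le_sup_right : ℚ_[p]⟮x⟯ ≤ X.K ⊔ ℚ_[p]⟮x⟯) (IntermediateField.mem_adjoin_simple_self ℚ_[p] x)
  exact hσ _ hE' x hxmem

/-- **`lim_{E′/E} Π^temp_{X_{E′}/E′} = Δ^temp_X`** — the group-theoretic content of display (3.10.2) / [André 2003b,
Prop. 5.1.1] in the [SemiAnbd] §6 interface (where `Δ^temp_X := Ker(Π^temp_{X/E} → G_E)` is «`π_1^temp(X_{K̄})`»): an
element lies in every `Π^temp_{X_{E′}/E′}` iff its image in `G_E` fixes every finite extension of `E`, iff that image is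
trivial. PROVED. [folklore] -/
theorem piTempLim_eq_deltaTemp (X : TemperedCurve p) : piTempLim X = X.DeltaTemp := by
  ext g
  rw [mem_piTempLim_iff, TemperedCurve.DeltaTemp, MonoidHom.mem_ker]
  constructor
  · intro hg
    have hmem : X.aug g ∈ ⨅ E' ∈ finExt X, E'.fixingSubgroup := by
      simp only [Subgroup.mem_iInf, IntermediateField.mem_fixingSubgroup_iff]
      exact hg
    rw [iInf_fixingSubgroup_finExt_eq_bot X, Subgroup.mem_bot] at hmem
    exact hmem
  · intro hg E' _ x _
    have hg' : X.aug g = 1 := hg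
    rw [hg']
    rfl

/-! ## 3. Thm. 3.10.1: the carrier `Π^temp_{X/K}` and items (1)–(3) -/
/-- **INTERIM CARRIER for `Π^temp_{X/K}`** (Thm. 3.10.1 p.11 l.20–51; §3.8 (3.8.1) p.10 l.25–38 «`Π^temp_{X/E} =
π_1^temp(X^an/E)`»; `Π^temp_{X/K}` is that of `X_K = X ×_E K`): for every `E`-untilt `K`, a topological group
`Π^temp_{X/K}` with the map `Π^temp_{X/K} → Π^temp_{X/E}` induced by `X_K → X` (the second arrow of item (2)). `π_1^temp`
of a Berkovich space over a perfectoid field ([André 2003b], [Lepage 2010]) is not in the tree: this is the SIGNATURE on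
which items (1)–(3) are stated; `GeomPiDatum.intrinsic` is its model inside the interface. TODO(general form): print's
`X/E` is any geometrically connected, smooth, quasi-projective variety. [claim: Joshi2021ATS1, status: disputed] -/
structure GeomPiDatum (X : TemperedCurve p) : Type 1 where
  /-- `Π^temp_{X/K}` -/
  Pi : EUntilt X → Type
  [group : ∀ K, Group (Pi K)]
  [topologicalSpace : ∀ K, TopologicalSpace (Pi K)]
  [isTopologicalGroup : ∀ K, IsTopologicalGroup (Pi K)]
  /-- `Π^temp_{X/K} → Π^temp_{X/E}` -/
  toBase : ∀ K, Pi K →ₜ* X.PiTemp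

namespace GeomPiDatum

attribute [instance] group topologicalSpace isTopologicalGroup

variable {X : TemperedCurve p} (D : GeomPiDatum X)

/-- **Thm. 3.10.1 (1), literal** (p.11 l.27–36): «a continuous isomorphism `Π^temp_{X/K} ≃ lim_{E′/E} Π^temp_{X/E′}`,
where the inverse limit is over all finite extensions `E′` of `E` contained in `K`» — a group isomorphism onto
`piTempLim X`, continuous, compatible with the maps to `Π^temp_{X/E}`. Typed, NOT asserted. [claim: Joshi2021ATS1, status: disputed] -/
@[claim "Joshi2021ATS1" "disputed"]
def Thm3101_1 : Prop :=
  ∀ K : EUntilt X, ∃ e : D.Pi K ≃* piTempLim X, Continuous e ∧ ∀ g, ((e g : piTempLim X) : X.PiTemp) = D.toBase K g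

/-- **Thm. 3.10.1 (1), reading «isomorphism of topological groups»** (the words of Thm. 3.16.1 (1), p.15 l.33, and of
the proof, p.12 l.10: «an isomorphism of topological groups `Π^temp_{X_K} ≃ Π^temp_{X_Ẽ}`» [Lepage 2010, Prop. 2.3.2]).
Typed, NOT asserted. [claim: Joshi2021ATS1, status: disputed] -/
@[claim "Joshi2021ATS1" "disputed"]
def Thm3101_1top : Prop :=
  ∀ K : EUntilt X, ∃ e : D.Pi K ≃ₜ* piTempLim X, ∀ g, ((e g : piTempLim X) : X.PiTemp) = D.toBase K g

/-- **Thm. 3.10.1 (2)** (p.11 l.37–43): «a short exact sequence of topological groups `1 → Π^temp_{X/K} → Π^temp_{X/E} →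
G_E → 1`» — exactness at the three places for the typed arrows (`D.toBase K`, the augmentation `X.aug` with `G_E =
X.GK`). Typed, NOT asserted (its third clause holds in the interface, `TemperedCurve.range_aug`). [claim: Joshi2021ATS1, status: disputed] -/
@[claim "Joshi2021ATS1" "disputed"]
def Thm3101_2 : Prop :=
  ∀ K : EUntilt X, Function.Injective (D.toBase K) ∧
    (D.toBase K).toMonoidHom.range = X.aug.toMonoidHom.ker ∧ X.aug.toMonoidHom.range = X.GK

/-- **Thm. 3.10.1 (3), literal** (p.11 l.44–51): «In particular for any two untilts `K₁, K₂` of `F`, one has a continuous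
isomorphism `Π^temp_{X/K₁} ≃ Π^temp_{X/K₂}`» («(3) is the new and important observation here», p.11 l.60).
Typed, NOT asserted. [claim: Joshi2021ATS1, status: disputed] -/
@[claim "Joshi2021ATS1" "disputed"]
def Thm3101_3 : Prop := ∀ K₁ K₂ : EUntilt X, ∃ e : D.Pi K₁ ≃* D.Pi K₂, Continuous e

/-- **Thm. 3.10.1 (3), reading «isomorphism of topological groups»** (= the statement Thm. 3.16.1 (1) repeats, p.15
l.33–40). Typed, NOT asserted. [claim: Joshi2021ATS1, status: disputed] -/
@[claim "Joshi2021ATS1" "disputed"]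
def Thm3101_3top : Prop := ∀ K₁ K₂ : EUntilt X, Nonempty (D.Pi K₁ ≃ₜ* D.Pi K₂)

/-- (1)top ⟹ (1). [folklore] -/
theorem thm3101_1_of_1top (h : D.Thm3101_1top) : D.Thm3101_1 := fun K =>
  let ⟨e, he⟩ := h K; ⟨e.toMulEquiv, e.continuous_toFun, he⟩

/-- (3)top ⟹ (3). [folklore] -/
theorem thm3101_3_of_3top (h : D.Thm3101_3top) : D.Thm3101_3 := fun K₁ K₂ =>
  let ⟨e⟩ := h K₁ K₂; ⟨e.toMulEquiv, e.continuous_toFun⟩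

/-- **The paper's proof of (3)** (p.12 l.41–51: «The claimed isomorphism `Π^temp_{X/K₁} ≃ Π^temp_{X/K₂}` follows from the
fact that both the groups can be identified with `lim_{E′/E} Π^temp_{X/E′}`»), in kernel form: (1)top ⟹ (3)top.
PROVED for the typed statements. [claim: Joshi2021ATS1, status: disputed] -/
theorem thm3101_3top_of_1top (h : D.Thm3101_1top) : D.Thm3101_3top := fun K₁ K₂ =>
  let ⟨e₁, _⟩ := h K₁; let ⟨e₂, _⟩ := h K₂; ⟨e₁.trans e₂.symm⟩

/-- **(1) ⟺ (2)** for the typed statements («Let me prove (1), this will also lead to (2)», p.11 l.64): by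
`piTempLim_eq_deltaTemp` the limit IS the kernel of `Π^temp_{X/E} → G_E`, and the augmentation is onto `G_E` in the
interface (`TemperedCurve.range_aug`); a continuous injective homomorphism onto the kernel is the same thing as a
continuous group isomorphism onto the limit compatible with the structure maps. PROVED. [folklore] -/
theorem thm3101_2_iff_1 : D.Thm3101_2 ↔ D.Thm3101_1 := by
  constructor
  · intro h K
    obtain ⟨hinj, hrange, -⟩ := h K
    have hmem : ∀ g, D.toBase K g ∈ piTempLim X := fun g =>
      (piTempLim_eq_deltaTemp X).ge (show D.toBase K g ∈ X.aug.toMonoidHom.ker from hrange ▸ ⟨g, rfl⟩)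
    let f : D.Pi K →* piTempLim X :=
      { toFun := fun g => ⟨D.toBase K g, hmem g⟩
        map_one' := Subtype.ext (map_one _)
        map_mul' := fun a b => Subtype.ext (map_mul _ a b) }
    have hf : Function.Bijective f := by
      refine ⟨fun a b hab => hinj (congrArg Subtype.val hab), fun y => ?_⟩
      have hy : (y : X.PiTemp) ∈ (D.toBase K).toMonoidHom.range := by
        rw [hrange]
        exact (piTempLim_eq_deltaTemp X).le y.2
      obtain ⟨g, hg⟩ := hy
      exact ⟨g, Subtype.ext hg⟩
    refine ⟨MulEquiv.ofBijective f hf, ?_, fun g => rfl⟩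
    exact Continuous.subtype_mk (D.toBase K).continuous_toFun _
  · intro h K
    obtain ⟨e, -, he⟩ := h K
    refine ⟨fun a b hab => e.injective (Subtype.ext (by rw [he, he, hab])), ?_, X.range_aug⟩
    ext g
    constructor
    · rintro ⟨a, rfl⟩
      have : ((e a : piTempLim X) : X.PiTemp) ∈ X.DeltaTemp := (piTempLim_eq_deltaTemp X).le (e a).2
      rw [he] at this
      exact this
    · intro hg
      have hg' : g ∈ piTempLim X := (piTempLim_eq_deltaTemp X).ge hg
      refine ⟨e.symm ⟨g, hg'⟩, ?_⟩
      have := he (e.symm ⟨g, hg'⟩)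
      rw [MulEquiv.apply_symm_apply] at this
      exact this.symm

variable (X) in
/-- **The intrinsic model**: `Π^temp_{X/K} := Δ^temp_X` for every `K`, with the inclusion — what item (3) says the groups
ARE up to isomorphism, and the reading under which E-t1's `ATSObj.geomSubgroup` is «the geometric subgroup provided by
`K`» («`Π^temp(Y/K) ≅ lim_{E″/E′} Π^temp(Y/E″)` is the kernel of the augmentation WHATEVER `K` is»). Used below as the
non-vacuity witness for items (1)–(3). [folklore] -/
def intrinsic : GeomPiDatum X where
  Pi _ := X.DeltaTemp
  toBase _ := ⟨X.DeltaTemp.subtype, continuous_subtype_val⟩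

variable (X) in
/-- NON-VACUITY: the intrinsic model satisfies (1)top (hence (1), (2), (3)top, (3)): `Δ^temp_X = lim_{E′} Π^temp_{X/E′}`
as subgroups (`piTempLim_eq_deltaTemp`), and equal subgroups are topologically isomorphic by the identity. [folklore] -/
theorem intrinsic_thm3101_1top : (intrinsic X).Thm3101_1top := fun K => by
  refine ⟨⟨MulEquiv.subgroupCongr (piTempLim_eq_deltaTemp X).symm, ?_, ?_⟩, fun g => rfl⟩
  · exact Continuous.subtype_mk continuous_subtype_val _
  · exact Continuous.subtype_mk continuous_subtype_val _

variable (X) in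
/-- … hence (2) and (3)top hold for it (items (1)–(3) are jointly satisfiable on the signature). [folklore] -/
theorem intrinsic_thm3101_2_and_3top : (intrinsic X).Thm3101_2 ∧ (intrinsic X).Thm3101_3top :=
  ⟨(thm3101_2_iff_1 _).2 (thm3101_1_of_1top _ (intrinsic_thm3101_1top X)),
    thm3101_3top_of_1top _ (intrinsic_thm3101_1top X)⟩

end GeomPiDatum

/-! ## 4. Rmks. 3.16.2, 3.16.3: uncountably many pairwise non-homeomorphic untilts (cited, unasserted) -/
variable (p) in
/-- **Rmk. 3.16.2** (p.16 l.5–7): «For the existence of uncountably many topologically non-isomorphic perfectoid fields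
see the construction of inequivalent valuations given by [Schmidt, 1933] (sketched here in Section 11) or [Kaplansky,
1942, Theorem 8]» — read for E-t1's `Untilt p` (algebraically closed, complete, characteristic `0`, residue
characteristic `p`): an uncountable set of pairwise NOT topologically isomorphic untilts. The REMARK's sentence, typed and
NOT asserted; its citations are the print's: [Kaplansky 1942, Thm. 8] is the UNIQUENESS of the maximally complete field
with given invariants (E-lit EL-131), the existence reading is Joshi's. [claim: Joshi2021ATS1, status: disputed] -/
@[claim "Joshi2021ATS1" "disputed"]
def ExistsUncountablyManyNonTopIso : Prop :=
  ∃ S : Set (Untilt p), ¬ S.Countable ∧ S.Pairwise fun U V => ¬ U.TopIso V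

/-- **Rmk. 3.16.3** (p.16 l.8–12): «the proof of [Kedlaya and Temkin, 2018] (also see [Matignon and Reversat, 1984,
Théorème 2 and §3 Remarque 2]) provides an uncountable collection of perfectoid fields `K₁, K₂` with tilts isometric to
`ℂ_p^♭` and such that `K₁, K₂` are not topologically isomorphic» — over E-t1's signature `UntiltPoints` (whose residue
fields `K_y` are the untilts of the fixed `F`): uncountably many points with pairwise non-homeomorphic residue fields.
Dot-notation extension of E-t1's structure declared from this file; cited, NOT asserted. [cite: KedlayaTemkin2018, Thm 1.3] -/
@[cite "KedlayaTemkin2018" "Thm 1.3"]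
def _root_.Summit.ABC.IUTFork.Joshi.UntiltPoints.ExistsUncountablyManyNonIsomorphic {𝒪E : Type} [CommRing 𝒪E]
    (D : UntiltPoints p 𝒪E) : Prop :=
  ∃ S : Set D.Pt, ¬ S.Countable ∧ S.Pairwise fun y y' => ¬ (D.untilt y).TopIso (D.untilt y')

/-- Rmk. 3.16.3 ⟹ the two-field statement E-t1 types as `UntiltPoints.ExistsNonIsomorphic` (§3.7 p.10 l.15–18, «there
exist untilts of `ℂ_p^♭` which are not topologically isomorphic»): an uncountable set has two distinct members.
PROVED (bookkeeping between cited `Prop`s). [folklore] -/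
theorem _root_.Summit.ABC.IUTFork.Joshi.UntiltPoints.existsNonIsomorphic_of_uncountablyMany {𝒪E : Type}
    [CommRing 𝒪E] (D : UntiltPoints p 𝒪E) (h : D.ExistsUncountablyManyNonIsomorphic) : D.ExistsNonIsomorphic := by
  obtain ⟨S, hS, hpair⟩ := h
  have hnt : S.Nontrivial := Set.not_subsingleton_iff.mp fun hsub => hS hsub.countable
  obtain ⟨y, hy, y', hy', hne⟩ := hnt
  exact ⟨y, y', hpair hy hy' hne⟩

/-! ## 5. Question 3.18.1 (typed as a question, one reading) -/
/-- **Question 3.18.1** (p.17 l.6–11): «Let `K` be a complete, algebraically closed valued field containing an isometric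
embedding of `E`. Is there some filtration by normal subgroups `Π^•_X ⊂ Π_X` which determines the pair of analytic
spaces `(X^an_E, X^an_K)` up to an isomorphism?» (context p.16 l.42 – p.17 l.5: `G_E` with its upper numbering
ramification filtration `G^•_E` determines `E` [Mochizuki 1997]; «many different filtrations `Π^•` each corresponding to
an algebraically closed, complete valued field `K ⊃ E`», p.17 l.16–18). A QUESTION, not a claim; ONE READING, typed, not
asserted: an assignment `K ↦ Π^•_X(K)` of decreasing filtrations of `Π_X = Π^temp_{X/E}` by normal subgroups, indexed by `ℝ`
(as the upper numbering filtration), such that equal filtrations force the `E`-untilts to be topologically isomorphic over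
`E` — the invariant of the pair that Thm. 3.16.1 (2) detects (Berkovich pairs are outside the tree). [claim: Joshi2021ATS1, status: disputed] -/
def Question3181 (X : TemperedCurve p) : Prop :=
  ∃ Φ : EUntilt X → ℝ → Subgroup X.PiTemp,
    (∀ K v, (Φ K v).Normal) ∧ (∀ K, Antitone (Φ K)) ∧
      ∀ K₁ K₂ : EUntilt X, Φ K₁ = Φ K₂ →
        ∃ e : K₁.U.TopEquiv K₂.U, ∀ x, e.toRingEquiv (K₁.ι x) = K₂.ι x

/-! ## 6. The [BGR] step of the proof of Thm. 3.16.1: bounded ⟹ isometric (classical, PROVED) -/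
/-- **Bounded ring homomorphisms of normed fields do not increase the norm** ([BGR 1984, 1.3.1 Prop. 4] as used on p.15
l.56 – p.16 l.3: «the norms are power-multiplicative. This implies … `K_i^∘ = {x ∈ K_i : |x|_{K_i} ≤ 1}`»): if `‖f x‖ ≤
C‖x‖` for all `x` then `‖f x‖ ≤ ‖x‖` — else `(‖f x‖/‖x‖)ⁿ` exceeds `C` while `‖f x‖ⁿ = ‖f(xⁿ)‖ ≤ C‖x‖ⁿ`. PROVED.
[cite: BoschGuntzerRemmert1984, 1.3.1 Prop 4] -/
theorem norm_map_le_of_bound {K L : Type} [NormedField K] [NormedField L] (f : K →+* L) (C : ℝ)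
    (hf : ∀ x, ‖f x‖ ≤ C * ‖x‖) (x : K) : ‖f x‖ ≤ ‖x‖ := by
  by_contra h
  rw [not_le] at h
  have hx0 : 0 < ‖x‖ := by
    rcases eq_or_lt_of_le (norm_nonneg x) with hx | hx
    · exfalso
      have hx' : x = 0 := norm_eq_zero.mp hx.symm
      rw [hx', map_zero, norm_zero, norm_zero] at h
      exact lt_irrefl _ h
    · exact hx
  have hr : 1 < ‖f x‖ / ‖x‖ := (one_lt_div hx0).mpr h
  obtain ⟨n, hn⟩ := pow_unbounded_of_one_lt C hr
  have h1 : ‖f x‖ ^ n ≤ C * ‖x‖ ^ n := by rw [← norm_pow, ← map_pow, ← norm_pow]; exact hf _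
  have h2 : C * ‖x‖ ^ n < ‖f x‖ ^ n := by
    have hxn : 0 < ‖x‖ ^ n := pow_pos hx0 n
    rw [div_pow, lt_div_iff₀ hxn] at hn
    exact hn
  exact lt_irrefl _ (h1.trans_lt h2)

/-- **A ring isomorphism of normed fields bounded in both directions is an isometry** ([BGR 1984, 1.2.5 Prop. 4, 1.3.1
Prop. 4]; the conclusion of the proof of Thm. 3.16.1, p.16 l.1–3: «the valued fields `K_i` have isomorphic valuation rings
and hence `K₁` and `K₂` are therefore isomorphic as valued fields»). PROVED. [cite: BoschGuntzerRemmert1984, 1.3.1 Prop 4] -/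
theorem norm_map_eq_of_bounded {K L : Type} [NormedField K] [NormedField L] (e : K ≃+* L) (C C' : ℝ)
    (he : ∀ x, ‖e x‖ ≤ C * ‖x‖) (he' : ∀ y, ‖e.symm y‖ ≤ C' * ‖y‖) (x : K) : ‖e x‖ = ‖x‖ := by
  refine le_antisymm (norm_map_le_of_bound e.toRingHom C he x) ?_
  have := norm_map_le_of_bound e.symm.toRingHom C' he' (e x)
  simpa using this

/-- **The [BGR] step for E-t1's untilts** (proof of Thm. 3.16.1, p.15 l.50 – p.16 l.3: «a bounded isomorphism of Banach
rings `K₁ ≃ H⁰(X^an/K₁, 𝒪) ≃ H⁰(X^an/K₂, 𝒪) ≃ K₂`. I claim that this is in fact an isomorphism of valued fields»): a ring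
isomorphism of untilts bounded both ways is a TOPOLOGICAL isomorphism in E-t1's sense (an isometry, `norm_map_eq_of_bounded`),
contradicting «not topologically isomorphic» as the proof concludes. Dot-notation extension of E-t1's `Untilt.TopEquiv`
declared from this file; classical, PROVED; Thm. 3.16.1 is not restated. [cite: BoschGuntzerRemmert1984, 1.2.5 Prop 4] -/
def _root_.Summit.ABC.IUTFork.Joshi.Untilt.TopEquiv.ofBounded {U V : Untilt p} (e : U.K ≃+* V.K) (C C' : ℝ)
    (he : ∀ x, ‖e x‖ ≤ C * ‖x‖) (he' : ∀ y, ‖e.symm y‖ ≤ C' * ‖y‖) : U.TopEquiv V where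
  toRingEquiv := e
  continuous_toFun := AddMonoidHomClass.continuous_of_bound e C he
  continuous_invFun := AddMonoidHomClass.continuous_of_bound e.symm C' he'

/-- … hence «topologically isomorphic» in E-t1's sense (`Untilt.TopIso`). [cite: BoschGuntzerRemmert1984, 1.2.5 Prop 4] -/
theorem _root_.Summit.ABC.IUTFork.Joshi.Untilt.topIso_of_bounded {U V : Untilt p} (e : U.K ≃+* V.K) (C C' : ℝ)
    (he : ∀ x, ‖e x‖ ≤ C * ‖x‖) (he' : ∀ y, ‖e.symm y‖ ≤ C' * ‖y‖) : U.TopIso V :=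
  ⟨Untilt.TopEquiv.ofBounded e C C' he he'⟩

end Summit.ABC.IUTFork.Joshi.ATS1

end
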